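import Summits.BirchSwinnertonDyer.BirchSwinnertonDyer.Theses.PrintX6
import Summits.BirchSwinnertonDyer.Rank1Residual.Supersingular.X6RankZeroErratumDefs
import Summits.BirchSwinnertonDyer.BirchSwinnertonDyer.Theorems.PrintX6LeafFromInputs
import HarnessLib

/-!
# Route `PrintX6`, EDIT #4 glue item `EisensteinHalfFiveLeOfParts` (road-(E) erratum-prime split of
# crux `EisensteinHalfFiveLe`, stmt-BirchSwinnertonDyer-20276): children ⟹ parent — PROVED

HONEST FRAMING (cell `bsd-print-x6`, run/shared/lean/pub/bsd-print-x6/; PRINT tier D-0131 (2);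
prover p2). THEOREMS ONLY; pure bookkeeping; nothing about any particular curve is asserted; BSD is
not proved by any of this; no cell of the partition moves.

EDIT #4 of route `PrintX6` (planner, PLAN.md v3.2/v3.3, HOME/plan/RUNBOOK-edit4.md) splits the crux
`EisensteinHalfFiveLe` (E₅: the Eisenstein/lower half of BSD(E,p) on the non-unit cells of the leaf
`ClassX6 ∧ r_an = 0` at `p ≥ 5`) along the DECIDABLE sub-class predicate
`Summit.BirchSwinnertonDyer.Rank1Residual.Supersingular.HasErratumPrime W p` (seat ty2, p544776:
`∃ q` prime with `q ‖ N`, NONSPLIT multiplicative reduction at `q`, `p ∤ ord_q Δ_min`) into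
* eight by-name Input items (`InputNewformExistence`, …, `InputCW24Thm53Cas18Thm32`) and the pack
  `PublishedAcInputsX6Err` (:= ty2's `Supersingular.PublishedAcInputsX6Err`, p548175),
* `EisensteinHalfFiveLeErr`  := pack → E₅ restricted to `HasErratumPrime W p` (ATTACKED: p3's
  anticyclotomic road (E), closer `…AnticyclotomicRankZero.eisensteinHalfFiveLeErr_of_facts`),
* `EisensteinHalfFiveLeRest` := E₅ restricted to `¬ HasErratumPrime W p` (declared RESIDUAL: BSTW
  Thm 1.3, PRE),
with the glue item `EisensteinHalfFiveLeOfParts : InputNewformExistence → … → PublishedAcInputsX6Err →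
EisensteinHalfFiveLeErr → EisensteinHalfFiveLeRest → EisensteinHalfFiveLe`. This file proves the glue:
ignore the eight Input binders (they only item-state the pack's conjuncts), feed the pack to the Err
child, and split on `HasErratumPrime W p` (classical `by_cases`; the predicate need not be decidable
for the proof). §F records, in route currency, that the split loses nothing and what the leaf's
deficit is afterwards: `PublishedAcInputsX6Err → (EisensteinHalfFiveLe ↔ Err ∧ Rest)`;
`PublishedInputsX6 → PublishedAcInputsX6Err → (WAllCornerX6r0 ↔ Err ∧ Rest ∧ EisensteinHalfAtThree)`
(over p2's `wallCornerX6r0_iff_eisensteinHalves_of_publishedInputsX6`, p538520); and, granted the Err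
child, `WAllCornerX6r0 ↔ EisensteinHalfFiveLeRest ∧ EisensteinHalfAtThree` — the route's declared
residual (tribunal_fit.residual) is EXACTLY the leaf's deficit over the refereed inputs, the HELD
anticyclotomic pack and road (E). beyond-print theorem: NO (bookkeeping); PARTITION: 0 cells.
[cite: Kobayashi2003, Thm. 1.2 (p. 2) and Thm. 4.1 (p. 8)] [cite: BDKim2013, Cor. 3.15 (p. 199)]
[cite: Miller2011LMS, §1 and Def. 1.1]
-/

set_option autoImplicit false
-- the landed namespace `Summit.BirchSwinnertonDyer.BirchSwinnertonDyer.Theorems` (summit = problem) trips the linter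
set_option linter.dupNamespace false

open Summit.BirchSwinnertonDyer.BirchSwinnertonDyer.Theses.PrintX6

namespace Summit.BirchSwinnertonDyer.BirchSwinnertonDyer.Theorems

/-- **The glue without the Input binders**: the anticyclotomic pack `PublishedAcInputsX6Err`, the
erratum sub-class crux `EisensteinHalfFiveLeErr` (pack → E₅ on `HasErratumPrime W p`) and the
residual crux `EisensteinHalfFiveLeRest` (E₅ on `¬ HasErratumPrime W p`) give back the parent crux
`EisensteinHalfFiveLe` — case split on `Supersingular.HasErratumPrime W p` (classical; pure logic).
[cite: Miller2011LMS, Def. 1.1] -/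
theorem eisensteinHalfFiveLe_of_publishedAcInputsX6Err_of_err_of_rest (hAc : PublishedAcInputsX6Err)
    (hErr : EisensteinHalfFiveLeErr) (hRest : EisensteinHalfFiveLeRest) : EisensteinHalfFiveLe := by
  intro W _ _ p _ hCM h5 hX hr q hq hv
  by_cases h : Summit.BirchSwinnertonDyer.Rank1Residual.Supersingular.HasErratumPrime W p
  · exact hErr hAc W p hCM h5 hX hr h q hq hv
  · exact hRest W p hCM h5 hX hr h q hq hv

/-- **Route `PrintX6`, glue item `EisensteinHalfFiveLeOfParts` (EDIT #4), PROVED**: the eight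
by-name Input items, the anticyclotomic pack `PublishedAcInputsX6Err`, the erratum sub-class crux
`EisensteinHalfFiveLeErr` and the residual crux `EisensteinHalfFiveLeRest` together give back the
parent crux `EisensteinHalfFiveLe` — by `eisensteinHalfFiveLe_of_publishedAcInputsX6Err_of_err_of_rest`;
the Input binders are not used (they item-state the pack's conjuncts for the route's deps rule; the
proof picks the three load-bearing hypotheses by type, so it is insensitive to their number). Closes
the glue item only; the two child cruxes stay open/residual as filed. [cite: Miller2011LMS, Def. 1.1] -/
theorem eisensteinHalfFiveLeOfParts_proof :
    Summit.BirchSwinnertonDyer.BirchSwinnertonDyer.Theses.PrintX6.EisensteinHalfFiveLeOfParts := by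
  unfold Summit.BirchSwinnertonDyer.BirchSwinnertonDyer.Theses.PrintX6.EisensteinHalfFiveLeOfParts
  intros
  exact eisensteinHalfFiveLe_of_publishedAcInputsX6Err_of_err_of_rest ‹PublishedAcInputsX6Err›
    ‹EisensteinHalfFiveLeErr› ‹EisensteinHalfFiveLeRest›

/-! ## §F — after EDIT #4 (erratum-prime split of `EisensteinHalfFiveLe`): the split loses nothing,
and over the refereed inputs + the anticyclotomic pack the leaf's deficit is EXACTLY
`EisensteinHalfFiveLeErr ∧ EisensteinHalfFiveLeRest ∧ EisensteinHalfAtThree`; once the Err child is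
closed (p3's road (E)), exactly `EisensteinHalfFiveLeRest ∧ EisensteinHalfAtThree` — the declared
residual of the route (tribunal_fit.residual). -/

/-- **Given the pack, parent ⟺ both children**: `PublishedAcInputsX6Err → (EisensteinHalfFiveLe ↔
EisensteinHalfFiveLeErr ∧ EisensteinHalfFiveLeRest)` — `←` is the glue's case split on
`Supersingular.HasErratumPrime W p`; `→` the two weakenings (the Err child ignores the pack and
restricts to `HasErratumPrime W p`, the Rest child to its negation; as separate lemmas they ride with
p1's by-name roads in `Theorems/PrintX6BSTWByNameRest.lean`). [cite: Miller2011LMS, Def. 1.1] -/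
theorem eisensteinHalfFiveLe_iff_children_of_publishedAcInputsX6Err (hAc : PublishedAcInputsX6Err) :
    EisensteinHalfFiveLe ↔ (EisensteinHalfFiveLeErr ∧ EisensteinHalfFiveLeRest) :=
  ⟨fun h => ⟨fun _ W _ _ p _ hCM h5 hX hr _ q hq hv => h W p hCM h5 hX hr q hq hv,
      fun W _ _ p _ hCM h5 hX hr _ q hq hv => h W p hCM h5 hX hr q hq hv⟩,
    fun h => eisensteinHalfFiveLe_of_publishedAcInputsX6Err_of_err_of_rest hAc h.1 h.2⟩

/-- **The leaf's deficit after EDIT #4, route currency**: granted the nine refereed inputs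
`PublishedInputsX6` and the anticyclotomic pack `PublishedAcInputsX6Err`, the rung `WAllCornerX6r0`
(leaf `ClassX6 ∧ r_an = 0`) holds IFF the three cruxes `EisensteinHalfFiveLeErr`,
`EisensteinHalfFiveLeRest`, `EisensteinHalfAtThree` do (`→`: each is a weakening of BSD(E,p) on the
leaf, via `eisensteinHalfFiveLe_of_wallCornerX6r0` / `eisensteinHalfAtThree_of_wallCornerX6r0` with GZK
from the inputs; `←`: glue + `printX6_assembly_proof` with `upperHalfX6_proof`).
[cite: Kobayashi2003, Thm. 1.2 (p. 2) and Thm. 4.1 (p. 8)] [cite: BDKim2013, Cor. 3.15 (p. 199)]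
[cite: Miller2011LMS, §1 and Def. 1.1] -/
theorem wallCornerX6r0_iff_children_and_atThree_of_publishedInputsX6 (hPub : PublishedInputsX6)
    (hAc : PublishedAcInputsX6Err) :
    Summit.BirchSwinnertonDyer.WAllCornerX6r0 ↔
      (EisensteinHalfFiveLeErr ∧ EisensteinHalfFiveLeRest ∧ EisensteinHalfAtThree) := by
  rw [wallCornerX6r0_iff_eisensteinHalves_of_publishedInputsX6 hPub,
    eisensteinHalfFiveLe_iff_children_of_publishedAcInputsX6Err hAc, and_assoc]

/-- **The declared residual, route currency**: granted `PublishedInputsX6`, the pack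
`PublishedAcInputsX6Err` and the erratum sub-class crux `EisensteinHalfFiveLeErr` (road (E), prover
p3), the rung `WAllCornerX6r0` holds IFF `EisensteinHalfFiveLeRest ∧ EisensteinHalfAtThree` — the two
cruxes the route declares RESIDUAL (BSTW arXiv:2409.01350 Thm 1.3: its p ≥ 5 tier off the erratum
sub-locus, its p = 3 tier). Nothing else of the leaf is missing over these inputs, and nothing less suffices.
[cite: Kobayashi2003, Thm. 1.2 (p. 2) and Thm. 4.1 (p. 8)] [cite: BDKim2013, Cor. 3.15 (p. 199)]
[cite: Miller2011LMS, §1 and Def. 1.1] -/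
theorem wallCornerX6r0_iff_rest_and_atThree_of_publishedInputsX6_of_err (hPub : PublishedInputsX6)
    (hAc : PublishedAcInputsX6Err) (hErr : EisensteinHalfFiveLeErr) :
    Summit.BirchSwinnertonDyer.WAllCornerX6r0 ↔ (EisensteinHalfFiveLeRest ∧ EisensteinHalfAtThree) := by
  rw [wallCornerX6r0_iff_children_and_atThree_of_publishedInputsX6 hPub hAc]
  exact ⟨fun h => h.2, fun h => ⟨hErr, h⟩⟩

/-- **Unconditional direction**: the rung implies the two residual cruxes outright (GZK only, from
the inputs' ninth conjunct). [cite: Miller2011LMS, §1 and Def. 1.1] -/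
theorem rest_and_atThree_of_wallCornerX6r0
    (hGZK : Literature.NumberTheory.EllipticCurves.rank_eq_analyticRank_of_analyticRank_le_one)
    (h : Summit.BirchSwinnertonDyer.WAllCornerX6r0) :
    EisensteinHalfFiveLeRest ∧ EisensteinHalfAtThree :=
  ⟨fun W _ _ p _ hCM h5 hX hr _ q hq hv =>
      eisensteinHalfFiveLe_of_wallCornerX6r0 hGZK h W p hCM h5 hX hr q hq hv,
    eisensteinHalfAtThree_of_wallCornerX6r0 hGZK h⟩

end Summit.BirchSwinnertonDyer.BirchSwinnertonDyer.Theorems
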